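import Literature.Probability.Process.FreedmanInequality
import Mathlib.Probability.BorelCantelli
import HarnessLib

/-!
# Freedman's inequality — two processes inhabiting its hypotheses

Topic `Probability/Process`; theorems only. Companion of `FreedmanInequality.lean`: the hypothesis
class «`Z_i ∈ [0,1]` revealed after round `i`, predictable `ϕ_i ≥ 0`, `E[Z_i | ℱ i] ≤ ϕ_i`» is
inhabited at both ends. Independent rounds inhabit the hypotheses with the natural filtration
(`iid_adaptive_tail`, Mathlib `iIndepFun.condExp_natural_ae_eq_of_lt`), and so does the maximally
correlated process «every round repeats round 1's outcome, priced predictably by `ϕ'_i = W_1`»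
(`correlated_inhabitant`, `Z'_1 = Z'_0`): the class is not an independence class in disguise.

Sources as in `FreedmanInequality.lean` [cite: Freedman1973] and, for the independent case as it is
printed, Liu et al., Nature 640 (2025) 343, SM §III.D (III.14)–(III.17)
[cite: LiuEtAl2025CertifiedRandomness] .
Provenance: cell qa-cr line `adaptive-budget-supermartingale` (qa-cr-idea-11), part A2; scratch §2a
byte-identical.
-/

noncomputable section

open MeasureTheory Filter Finset Real

namespace Literature.Probability.Process

variable {Ω : Type*} {m0 : MeasurableSpace Ω}

/-! ## §2a Non-vacuity: the printed i.i.d. rounds inhabit the adaptive hypotheses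

The printed model (classical rounds i.i.d., `P(Z_i = 1) = ϕ`) is the special case «natural
filtration, constant `ϕ_i`»: by independence `E[Z_{i+1} | σ(Z_0,…,Z_i)] = E[Z_{i+1}]` a.e. (Mathlib
`ProbabilityTheory.iIndepFun.condExp_natural_ae_eq_of_lt`). So (T1)'s hypothesis set is inhabited by
the tree's own setting (rounds re-indexed from `1`), and (T2) contains the printed Chernoff regime.
-/

/-- Independent rounds satisfy the conditional-mean hypothesis with CONSTANT predictable prices:
`E[W (i+1) | σ(W 0, …, W i)] = E[W (i+1)] ≤ p i` a.e. (Mathlib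
`ProbabilityTheory.iIndepFun.condExp_natural_ae_eq_of_lt`).
[cite: LiuEtAl2025CertifiedRandomness, SM §III.D (III.14)–(III.15) (the i.i.d. classical rounds)] -/
theorem hmean_of_iIndepFun {μ : Measure Ω} {W : ℕ → Ω → ℝ} (hW : ∀ i, StronglyMeasurable (W i))
    (hind : ProbabilityTheory.iIndepFun W μ) {p : ℕ → ℝ} (hp : ∀ i, ∫ ω, W (i + 1) ω ∂μ ≤ p i)
    (i : ℕ) :
    μ[W (i + 1) | Filtration.natural W hW i] ≤ᵐ[μ] fun _ => p i := by
  filter_upwards [hind.condExp_natural_ae_eq_of_lt hW (Nat.lt_succ_self i)] with ω hω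
  rw [hω]
  exact hp i

/-- The i.i.d. model of the printed analysis satisfies (T2) with the natural filtration: for
independent `[0,1]`-valued rounds `W 1, W 2, …` with `E[W (i+1)] ≤ p i`,
`P(∃ n, a ≤ Σ_{i<n} W (i+1) ∧ Σ_{i<n} p i ≤ Φ) ≤ exp(−(λa − (e^λ−1)Φ))` — Freedman's (4) contains
the independent (Chernoff) case. [cite: Freedman1973, ineq. (4)]
[cite: LiuEtAl2025CertifiedRandomness, SM §III.D (III.14)–(III.17)] -/
theorem iid_adaptive_tail {μ : Measure Ω} {W : ℕ → Ω → ℝ} (hW : ∀ i, StronglyMeasurable (W i))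
    (hind : ProbabilityTheory.iIndepFun W μ) (hW01 : ∀ i ω, W i ω ∈ Set.Icc (0 : ℝ) 1) {p : ℕ → ℝ}
    (hp0 : ∀ i, 0 ≤ p i)
    (hp : ∀ i, ∫ ω, W (i + 1) ω ∂μ ≤ p i) {l : ℝ} (hl : 0 ≤ l) (a Φ : ℝ) :
    μ.real {ω | ∃ n, a ≤ ∑ i ∈ range n, W (i + 1) ω ∧ ∑ i ∈ range n, p i ≤ Φ} ≤
      Real.exp (-(l * a - (Real.exp l - 1) * Φ)) := by
  haveI : IsProbabilityMeasure μ := hind.isProbabilityMeasure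
  have hZ : ∀ i, StronglyMeasurable[Filtration.natural W hW (i + 1)] (W (i + 1)) := fun i =>
    (Filtration.stronglyAdapted_natural hW) (i + 1)
  have hphi : ∀ i, StronglyMeasurable[Filtration.natural W hW i] (fun _ : Ω => p i) := fun i =>
    stronglyMeasurable_const
  exact adaptive_tail (ℱ := Filtration.natural W hW) (Z := fun i => W (i + 1))
    (phi := fun i _ => p i)
    hZ hphi hl (fun i ω => hW01 (i + 1) ω) (fun i _ => hp0 i) (hmean_of_iIndepFun hW hind hp) a Φ

/-- **A genuinely adaptive (maximally correlated) inhabitant.** From independent `[0,1]`-valued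
rounds `W`, let EVERY round report round 1's outcome: `Z' i := W 1` for all `i`, priced predictably
by `ϕ' 0 := p ≥ E[W 1]` and `ϕ' i := W 1` for `i ≥ 1` (legal: `W 1` is known from time `1` on). All
four hypotheses of (T1)/(T2) hold with the natural filtration although `Z' 1 = Z' 0` identically —
the class is not an independence class in disguise.
[cite: Freedman1973, ineq. (4) (hypotheses only: `0 ≤ X_n ≤ 1`, `p_n = E[X_n | ℱ_{n−1}] `, no
independence)] -/
theorem correlated_inhabitant {μ : Measure Ω} {W : ℕ → Ω → ℝ} (hW : ∀ i, StronglyMeasurable (W i))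
    (hind : ProbabilityTheory.iIndepFun W μ) (hW01 : ∀ i ω, W i ω ∈ Set.Icc (0 : ℝ) 1) {p : ℝ}
    (hp : ∫ ω, W 1 ω ∂μ ≤ p) :
    let ℱ := Filtration.natural W hW
    let Z' : ℕ → Ω → ℝ := fun _ => W 1
    let phi' : ℕ → Ω → ℝ := fun i ω => if i = 0 then p else W 1 ω
    (∀ i, StronglyMeasurable[ℱ (i + 1)] (Z' i)) ∧ (∀ i, StronglyMeasurable[ℱ i] (phi' i)) ∧
      (∀ i, μ[Z' i | ℱ i] ≤ᵐ[μ] phi' i) ∧ (∀ i ω, Z' i ω ∈ Set.Icc (0 : ℝ) 1) ∧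
      ∀ ω, Z' 1 ω = Z' 0 ω := by
  haveI : IsProbabilityMeasure μ := hind.isProbabilityMeasure
  intro ℱ Z' phi'
  have h1 : StronglyMeasurable[ℱ 1] (W 1) := (Filtration.stronglyAdapted_natural hW) 1
  have hZ' : ∀ i, StronglyMeasurable[ℱ (i + 1)] (Z' i) := fun i =>
    h1.mono (ℱ.mono (by omega))
  have hphi' : ∀ i, StronglyMeasurable[ℱ i] (phi' i) := by
    intro i
    rcases Nat.eq_zero_or_pos i with h0 | hpos
    · subst h0
      simpa [phi'] using (stronglyMeasurable_const : StronglyMeasurable[ℱ 0] fun _ : Ω => p)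
    · have : phi' i = W 1 := by
        funext ω; simp [phi', Nat.pos_iff_ne_zero.mp hpos]
      rw [this]; exact h1.mono (ℱ.mono hpos)
  refine ⟨hZ', hphi', ?_, fun i ω => hW01 1 ω, fun ω => rfl⟩
  intro i
  have hZ'i : Z' i = W 1 := rfl
  rcases Nat.eq_zero_or_pos i with h0 | hpos
  · subst h0
    have hphi0 : phi' 0 = fun _ => p := by funext ω; simp [phi']
    rw [hZ'i, hphi0]
    filter_upwards [hind.condExp_natural_ae_eq_of_lt hW (zero_lt_one : (0 : ℕ) < 1)] with ω hω
    rw [hω]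
    exact hp
  · have hint : Integrable (W 1) μ := Integrable.of_bound (hW 1).aestronglyMeasurable 1
      (Filter.Eventually.of_forall fun ω => by
        rw [Real.norm_eq_abs, abs_le]; exact ⟨by linarith [(hW01 1 ω).1], (hW01 1 ω).2⟩)
    have heq : μ[W 1 | ℱ i] = W 1 :=
      condExp_of_stronglyMeasurable (ℱ.le i) (h1.mono (ℱ.mono hpos)) hint
    have hphii : phi' i = W 1 := by
      funext ω; simp [phi', Nat.pos_iff_ne_zero.mp hpos]
    rw [hZ'i, hphii, heq]

end Literature.Probability.Process
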